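import Summits.FinalStateConjecture.FinalStateConjecture.Theorems.UniformPhotonSphereChannels.Negative.EnergyDefectIdentity
import Summits.FinalStateConjecture.FinalStateConjecture.Theorems.PhotonSphereChannelsExteriorEnergy
import Literature.Analysis.ODE.LinearComparison
import Literature.Geometry.Lorentzian.ReggeWheelerChannels

/-!
# Route PhotonSphereChannels · `UniformPhotonSphereChannels` (K1) — the energy of a compactly
# supported `C²` field with zero Cauchy data is controlled by its defect

Support file for item stmt-FinalStateConjecture-10045 (registered sub-goal
`stub_restPacket_energyBound` of prover seat 1).  In the rest-packet refutation of K1 the exact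
Regge–Wheeler solution `φ` with the packet's Cauchy data is compared with the explicit packet
`ψ_app`; the difference `w = φ − ψ_app` has ZERO Cauchy data, compact spatial support on every time
slab, and a small defect `F = w_tt − w_xx + V w = −(residual of ψ_app)`.  This file proves the
standard a priori estimate in the form the assembly consumes:

* `total_energy_le_of_defect` — if `w ∈ C²(ℝ²)` vanishes for `x < a + 1` and for `x > b − 1` at all
  times `|t| < T + 1`, has zero Cauchy data at `t = 0`, and `|w_tt − w_xx + V w| ≤ K` on
  `[−T, T] × ℝ` (`V ∈ C¹`, `V ≥ 0`), then for every `|t| ≤ T` the total energy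
  `∫⁻ (w_t² + w_x² + V w²)(t,·)` is at most `e · (b − a) · K² · T²`.

Proof: the energy identity with defect source of `WaveDefect.energy_identity_affine_source`
(refuter seat of this item) on the fixed interval `[a, b]` — the momentum flux through `x = a, b`
vanishes by support — gives `E(t) = ∫_0^t ∫_a^b 2 w_t F`; with `2 w_t F ≤ T⁻¹ w_t² + T F²` this is the
linear differential inequality `E' ≤ T⁻¹ E + (b − a) K² T`, integrated by the variable-coefficient
Grönwall lemma `Literature.Analysis.ODE.le_linearComparison` in both time directions.
No definitions are introduced.
-/

noncomputable section

open Set Filter MeasureTheory intervalIntegral Topology Function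

namespace Summit.FinalStateConjecture.FinalStateConjecture.Theorems.RestPacket

open Summit.FinalStateConjecture.FinalStateConjecture.Theorems.WaveEnergy
open Summit.FinalStateConjecture.FinalStateConjecture.Theorems.WaveDefect
open Literature.Geometry.Lorentzian.ReggeWheeler (energyDensity)

variable {w : ℝ → ℝ → ℝ} {V : ℝ → ℝ}

/-- A function vanishing on an open set has vanishing Fréchet derivative there. -/
theorem fderiv_eq_zero_of_eventuallyEq_zero {u : ℝ × ℝ → ℝ} {z : ℝ × ℝ}
    (h : u =ᶠ[𝓝 z] fun _ => 0) : fderiv ℝ u z = 0 := by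
  rw [h.fderiv_eq]; simp

/-- The support hypothesis read on the uncurried function: `uncurry w` vanishes near `(t, x)` for
`|t| < T + 1` and `x < a + 1` or `x > b − 1`. -/
theorem uncurry_eventuallyEq_zero {T a b : ℝ}
    (hsupp : ∀ t ∈ Ioo (-T - 1) (T + 1), ∀ x, (x < a + 1 ∨ b - 1 < x) → w t x = 0)
    {t x : ℝ} (ht : t ∈ Ioo (-T - 1) (T + 1)) (hx : x < a + 1 ∨ b - 1 < x) :
    uncurry w =ᶠ[𝓝 (t, x)] fun _ => 0 := by
  have hopen : IsOpen {p : ℝ × ℝ | p.1 ∈ Ioo (-T - 1) (T + 1) ∧ (p.2 < a + 1 ∨ b - 1 < p.2)} := by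
    refine (isOpen_Ioo.preimage continuous_fst).inter ?_
    exact (isOpen_lt continuous_snd continuous_const).union
      (isOpen_lt continuous_const continuous_snd)
  filter_upwards [hopen.mem_nhds (show (t, x) ∈ _ from ⟨ht, hx⟩)] with p hp
  exact hsupp p.1 hp.1 p.2 hp.2

/-- **A priori energy estimate from the defect.** See the module docstring. -/
theorem total_energy_le_of_defect (hw : ContDiff ℝ 2 (uncurry w)) (hV : ContDiff ℝ 1 V)
    (hV0 : ∀ x, 0 ≤ V x) {T a b K : ℝ} (hT : 0 < T) (hab : a + 1 < b - 1)
    (hsupp : ∀ t ∈ Ioo (-T - 1) (T + 1), ∀ x, (x < a + 1 ∨ b - 1 < x) → w t x = 0)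
    (h0 : ∀ x, w 0 x = 0) (h1 : ∀ x, deriv (fun τ => w τ x) 0 = 0)
    (hdef : ∀ t ∈ Icc (-T) T, ∀ x,
      |iteratedDeriv 2 (fun τ => w τ x) t - iteratedDeriv 2 (w t) x + V x * w t x| ≤ K) :
    ∀ t ∈ Icc (-T) T,
      (∫⁻ x, ENNReal.ofReal (energyDensity V w t x))
        ≤ ENNReal.ofReal (Real.exp 1 * (b - a) * K ^ 2 * T ^ 2) := by
  -- Fréchet set-up
  set u : ℝ × ℝ → ℝ := uncurry w with hu_def
  have hu : ContDiff ℝ 2 u := hw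
  set W : ℝ × ℝ → ℝ := fun z => V z.2 with hW_def
  have hW : ContDiff ℝ 1 W := hV.comp contDiff_snd
  have hWd : Differentiable ℝ W := hW.differentiable one_ne_zero
  have hW0 : ∀ z, 0 ≤ W z := fun z => hV0 z.2
  set e : ℝ × ℝ → ℝ := fun z =>
    (fderiv ℝ u z (1, 0)) ^ 2 + (fderiv ℝ u z (0, 1)) ^ 2 + W z * u z ^ 2 with he_def
  set m : ℝ × ℝ → ℝ := fun z => 2 * fderiv ℝ u z (1, 0) * fderiv ℝ u z (0, 1) with hm_def
  set F : ℝ × ℝ → ℝ := fun z => fderiv ℝ (fderiv ℝ u) z (1, 0) (1, 0)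
    - fderiv ℝ (fderiv ℝ u) z (0, 1) (0, 1) + W z * u z with hF_def
  have he : ∀ z, e z = (fderiv ℝ u z (1, 0)) ^ 2 + (fderiv ℝ u z (0, 1)) ^ 2 + W z * u z ^ 2 :=
    fun z => rfl
  have hm : ∀ z, m z = 2 * fderiv ℝ u z (1, 0) * fderiv ℝ u z (0, 1) := fun z => rfl
  have hF : ∀ z, F z = fderiv ℝ (fderiv ℝ u) z (1, 0) (1, 0)
      - fderiv ℝ (fderiv ℝ u) z (0, 1) (0, 1) + W z * u z := fun z => rfl
  have hec : Continuous e := (WaveDefect.differentiable_energyDensity hu hWd he).continuous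
  have hFc : Continuous F := continuous_defect hu hW.continuous hF
  have he0 : ∀ z, 0 ≤ e z := fun z => WaveDefect.energyDensity_nonneg hW0 he z
  -- `∂ₜ W = 0`
  have hWt : ∀ z, fderiv ℝ W z (1, 0) = 0 := by
    intro z
    have h := ((hV.differentiable one_ne_zero) z.2).hasFDerivAt.comp z hasFDerivAt_snd
    have h' : HasFDerivAt W ((fderiv ℝ V z.2).comp (ContinuousLinearMap.snd ℝ ℝ ℝ)) z :=
      h.congr_of_eventuallyEq (Eventually.of_forall fun _ => rfl)
    rw [h'.fderiv]
    simp
  -- dictionary with the curried vocabulary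
  have hdt : ∀ t x, deriv (fun τ => w τ x) t = fderiv ℝ u (t, x) (1, 0) :=
    fun t x => deriv_slice_fst_eq hw t x
  have hdx : ∀ t x, deriv (w t) x = fderiv ℝ u (t, x) (0, 1) :=
    fun t x => deriv_slice_snd_eq hw t x
  have hFdef : ∀ t x, F (t, x)
      = iteratedDeriv 2 (fun τ => w τ x) t - iteratedDeriv 2 (w t) x + V x * w t x := by
    intro t x
    rw [hF, iteratedDeriv_two_slice_fst_eq hw, iteratedDeriv_two_slice_snd_eq hw]
    rfl
  have hedens : ∀ t x, energyDensity V w t x = e (t, x) := by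
    intro t x
    unfold energyDensity
    rw [hdt, hdx]
    rfl
  -- the defect bound and the support in Fréchet form
  have hFK : ∀ t ∈ Icc (-T) T, ∀ x, |F (t, x)| ≤ K := fun t ht x => by
    rw [hFdef]; exact hdef t ht x
  have hTT : Icc (-T) T ⊆ Ioo (-T - 1) (T + 1) := fun t ht => ⟨by linarith [ht.1], by linarith [ht.2]⟩
  have hzero : ∀ t ∈ Ioo (-T - 1) (T + 1), ∀ x, (x < a + 1 ∨ b - 1 < x) →
      u (t, x) = 0 ∧ fderiv ℝ u (t, x) = 0 := by
    intro t ht x hx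
    have hev := uncurry_eventuallyEq_zero hsupp ht hx
    exact ⟨hsupp t ht x hx, fderiv_eq_zero_of_eventuallyEq_zero hev⟩
  have hm0 : ∀ t ∈ Ioo (-T - 1) (T + 1), ∀ x, (x < a + 1 ∨ b - 1 < x) → m (t, x) = 0 := by
    intro t ht x hx
    rw [hm, (hzero t ht x hx).2]; simp
  have he0' : ∀ t ∈ Ioo (-T - 1) (T + 1), ∀ x, (x < a + 1 ∨ b - 1 < x) → e (t, x) = 0 := by
    intro t ht x hx
    rw [he, (hzero t ht x hx).1, (hzero t ht x hx).2]; simp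
  -- the energy identity on `[a, b]` between times in `[-T, T]`
  set E : ℝ → ℝ := fun t => ∫ x in a..b, e (t, x) with hE_def
  set G : ℝ → ℝ := fun t => ∫ x in a..b, 2 * fderiv ℝ u (t, x) (1, 0) * F (t, x) with hG_def
  have hab' : a ≤ b := by linarith
  have hident : ∀ t₁ ∈ Icc (-T) T, ∀ t₂ ∈ Icc (-T) T, E t₂ - E t₁ = ∫ t in t₁..t₂, G t := by
    intro t₁ ht₁ t₂ ht₂
    have key := energy_identity_affine_source hu hW he hm hF a 0 b 0 t₁ t₂
    simp only [zero_mul, add_zero] at key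
    have hflux : ∫ t in t₁..t₂, (m (t, b) - m (t, a)) = 0 := by
      have hcg : ∫ t in t₁..t₂, (m (t, b) - m (t, a)) = ∫ t in t₁..t₂, (0 : ℝ) := by
        refine intervalIntegral.integral_congr fun t ht => ?_
        have ht' : t ∈ Ioo (-T - 1) (T + 1) := by
          rcases le_total t₁ t₂ with h | h
          · rw [uIcc_of_le h] at ht
            exact ⟨by linarith [ht.1, ht₁.1], by linarith [ht.2, ht₂.2]⟩
          · rw [uIcc_of_ge h] at ht
            exact ⟨by linarith [ht.1, ht₂.1], by linarith [ht.2, ht₁.2]⟩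
        simp only [hm0 t ht' b (Or.inr (by linarith)), hm0 t ht' a (Or.inl (by linarith)), sub_zero]
      rw [hcg, intervalIntegral.integral_zero]
    have hsrc : (∫ t in t₁..t₂, ∫ x in a..b,
        (2 * fderiv ℝ u (t, x) (1, 0) * F (t, x) + fderiv ℝ W (t, x) (1, 0) * u (t, x) ^ 2))
        = ∫ t in t₁..t₂, G t := by
      refine intervalIntegral.integral_congr fun t _ => ?_
      simp only [hG_def, hWt, zero_mul, add_zero]
    simp only [hE_def]
    rw [key, hflux, hsrc, zero_add]
  -- continuity of `G`
  have hGc : Continuous G := by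
    have hint : Continuous (uncurry fun (t x : ℝ) => 2 * fderiv ℝ u (t, x) (1, 0) * F (t, x)) := by
      have h1 : Continuous fun p : ℝ × ℝ => fderiv ℝ u (p.1, p.2) (1, 0) :=
        continuous_fderiv_apply hu (1, 0)
      exact (continuous_const.mul h1).mul (hFc.comp (continuous_fst.prodMk continuous_snd))
    exact continuous_parametric_intervalIntegral_of_continuous (a₀ := a) hint continuous_const
  -- zero initial energy
  have hE0 : E 0 = 0 := by
    have hcg : (∫ x in a..b, e (0, x)) = ∫ x in a..b, (0 : ℝ) := by
      refine intervalIntegral.integral_congr fun x _ => ?_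
      have hux : fderiv ℝ u (0, x) (0, 1) = 0 := by
        rw [← hdx]
        have : w 0 = fun _ => 0 := funext h0
        rw [this, deriv_const]
      have hut : fderiv ℝ u (0, x) (1, 0) = 0 := by rw [← hdt]; exact h1 x
      have hu0 : u (0, x) = 0 := h0 x
      rw [he, hux, hut, hu0]
      ring
    simp only [hE_def]
    rw [hcg, intervalIntegral.integral_zero]
  -- the differential inequality `G ≤ T⁻¹ E + (b - a) K² T` on `[-T, T]`
  set A : ℝ := (b - a) * K ^ 2 * T with hA_def
  have hA0 : 0 ≤ A := by simp only [hA_def]; positivity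
  have hGle : ∀ t ∈ Icc (-T) T, |G t| ≤ T⁻¹ * E t + A := by
    intro t ht
    have hpt : ∀ x ∈ Icc a b, |2 * fderiv ℝ u (t, x) (1, 0) * F (t, x)|
        ≤ T⁻¹ * e (t, x) + K ^ 2 * T := by
      intro x _
      set p := fderiv ℝ u (t, x) (1, 0)
      set f := F (t, x)
      have hf : |f| ≤ K := hFK t ht x
      have hp2 : p ^ 2 ≤ e (t, x) := by
        rw [he]
        nlinarith [sq_nonneg (fderiv ℝ u (t, x) (0, 1)), mul_nonneg (hW0 (t, x)) (sq_nonneg (u (t, x)))]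
      have hf2 : f ^ 2 ≤ K ^ 2 := by
        rw [← sq_abs f]; exact pow_le_pow_left₀ (abs_nonneg f) hf 2
      have hyoung : |2 * p * f| ≤ T⁻¹ * p ^ 2 + T * f ^ 2 := by
        rw [abs_le]
        have hTi : 0 < T⁻¹ := inv_pos.2 hT
        constructor
        · have h0 : 0 ≤ T⁻¹ * (p + T * f) ^ 2 := by positivity
          have : T⁻¹ * (p + T * f) ^ 2 = T⁻¹ * p ^ 2 + 2 * (T⁻¹ * T) * p * f + T⁻¹ * T * T * f ^ 2 := by
            ring
          rw [this, inv_mul_cancel₀ hT.ne'] at h0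
          linarith
        · have h0 : 0 ≤ T⁻¹ * (p - T * f) ^ 2 := by positivity
          have : T⁻¹ * (p - T * f) ^ 2 = T⁻¹ * p ^ 2 - 2 * (T⁻¹ * T) * p * f + T⁻¹ * T * T * f ^ 2 := by
            ring
          rw [this, inv_mul_cancel₀ hT.ne'] at h0
          linarith
      have hTi0 : 0 ≤ T⁻¹ := (inv_pos.2 hT).le
      nlinarith [mul_le_mul_of_nonneg_left hp2 hTi0, mul_le_mul_of_nonneg_left hf2 hT.le]
    have hcont1 : Continuous fun x => 2 * fderiv ℝ u (t, x) (1, 0) * F (t, x) :=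
      (continuous_const.mul ((continuous_fderiv_apply hu (1, 0)).comp
        (Continuous.prodMk_right t))).mul (hFc.comp (Continuous.prodMk_right t))
    calc |G t| ≤ ∫ x in a..b, |2 * fderiv ℝ u (t, x) (1, 0) * F (t, x)| := by
          simp only [hG_def]
          exact intervalIntegral.abs_integral_le_integral_abs hab'
      _ ≤ ∫ x in a..b, (T⁻¹ * e (t, x) + K ^ 2 * T) :=
          intervalIntegral.integral_mono_on hab' (hcont1.abs.intervalIntegrable _ _)
            ((by fun_prop : Continuous fun x => T⁻¹ * e (t, x) + K ^ 2 * T).intervalIntegrable _ _)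
            hpt
      _ = T⁻¹ * E t + A := by
          have hi1 : IntervalIntegrable (fun x => T⁻¹ * e (t, x)) volume a b :=
            (by fun_prop : Continuous fun x => T⁻¹ * e (t, x)).intervalIntegrable a b
          have hi2 : IntervalIntegrable (fun _ : ℝ => K ^ 2 * T) volume a b :=
            intervalIntegrable_const
          rw [intervalIntegral.integral_add hi1 hi2, intervalIntegral.integral_const_mul,
            intervalIntegral.integral_const]
          simp only [smul_eq_mul, hE_def, hA_def]
          ring
  -- the global primitive `g t = ∫_0^t G` agrees with `E` on `[-T, T]`
  set g : ℝ → ℝ := fun t => ∫ s in (0 : ℝ)..t, G s with hg_def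
  have hgE : ∀ t ∈ Icc (-T) T, g t = E t := by
    intro t ht
    have := hident 0 ⟨by linarith, hT.le⟩ t ht
    rw [hE0, sub_zero] at this
    exact this.symm
  have hgd : ∀ t, HasDerivAt g (G t) t := fun t =>
    integral_hasDerivAt_right (hGc.intervalIntegrable _ _) (hGc.stronglyMeasurableAtFilter _ _)
      hGc.continuousAt
  have hE_nonneg : ∀ t, 0 ≤ E t := fun t =>
    intervalIntegral.integral_nonneg hab' fun x _ => he0 (t, x)
  -- forward Grönwall on `[0, T]`
  have hfwd : ∀ t ∈ Icc 0 T, E t ≤ Real.exp 1 * A * T := by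
    intro t ht
    have key := Literature.Analysis.ODE.le_linearComparison (a := 0) (b := T) (g := g) (g' := G)
      (A := fun _ => A) (β := fun _ => T⁻¹)
      (fun s _ => (hgd s).continuousAt.continuousWithinAt)
      (fun s _ => (hgd s).hasDerivWithinAt) continuousOn_const continuousOn_const
      (fun s hs => by
        have hs' : s ∈ Icc (-T) T := ⟨by linarith [hs.1], hs.2.le⟩
        have h := (abs_le.1 (hGle s hs')).2
        rw [hgE s hs'] ; linarith) ht
    have hg0 : g 0 = 0 := by simp [hg_def]
    rw [hg0, zero_add, hgE t ⟨by linarith [ht.1], ht.2⟩] at key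
    have hI : ∫ s in (0 : ℝ)..t, A * Real.exp (-∫ u in (0 : ℝ)..s, T⁻¹) ≤ A * T := by
      have h1 : ∫ s in (0 : ℝ)..t, A * Real.exp (-∫ u in (0 : ℝ)..s, T⁻¹) ≤ ∫ s in (0 : ℝ)..t, A := by
        refine intervalIntegral.integral_mono_on ht.1 ?_ intervalIntegrable_const fun s hs => ?_
        · have hcont : Continuous fun s : ℝ => A * Real.exp (-∫ u in (0 : ℝ)..s, T⁻¹) := by
            simp only [intervalIntegral.integral_const, sub_zero, smul_eq_mul]
            fun_prop
          exact hcont.intervalIntegrable _ _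
        · have : Real.exp (-∫ u in (0 : ℝ)..s, T⁻¹) ≤ 1 := by
            rw [intervalIntegral.integral_const, smul_eq_mul, Real.exp_le_one_iff]
            have : 0 ≤ (s - 0) * T⁻¹ := mul_nonneg (by linarith [hs.1]) (inv_pos.2 hT).le
            linarith
          calc A * Real.exp (-∫ u in (0 : ℝ)..s, T⁻¹) ≤ A * 1 :=
                mul_le_mul_of_nonneg_left this hA0
            _ = A := mul_one A
      have h2 : ∫ s in (0 : ℝ)..t, A = A * t := by
        rw [intervalIntegral.integral_const, smul_eq_mul]; ring
      rw [h2] at h1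
      exact h1.trans (mul_le_mul_of_nonneg_left ht.2 hA0)
    have hexp : Real.exp (∫ s in (0 : ℝ)..t, T⁻¹) ≤ Real.exp 1 := by
      rw [intervalIntegral.integral_const, smul_eq_mul, Real.exp_le_exp, sub_zero]
      calc t * T⁻¹ ≤ T * T⁻¹ := mul_le_mul_of_nonneg_right ht.2 (inv_pos.2 hT).le
        _ = 1 := mul_inv_cancel₀ hT.ne'
    calc E t ≤ Real.exp (∫ s in (0 : ℝ)..t, T⁻¹)
          * ∫ s in (0 : ℝ)..t, A * Real.exp (-∫ u in (0 : ℝ)..s, T⁻¹) := key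
      _ ≤ Real.exp 1 * (A * T) :=
          mul_le_mul hexp hI (intervalIntegral.integral_nonneg ht.1 fun s _ => by positivity)
            (Real.exp_pos _).le
      _ = Real.exp 1 * A * T := by ring
  -- backward Grönwall on `[-T, 0]` via `s ↦ g (-s)`
  have hbwd : ∀ t ∈ Icc (-T) 0, E t ≤ Real.exp 1 * A * T := by
    intro t ht
    set gr : ℝ → ℝ := fun s => g (-s) with hgr_def
    have hgrd : ∀ s, HasDerivAt gr (-G (-s)) s := fun s => by
      have h := (hgd (-s)).comp s (hasDerivAt_neg s)
      refine (h.congr_of_eventuallyEq (Eventually.of_forall fun _ => rfl)).congr_deriv ?_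
      ring
    have key := Literature.Analysis.ODE.le_linearComparison (a := 0) (b := T) (g := gr)
      (g' := fun s => -G (-s)) (A := fun _ => A) (β := fun _ => T⁻¹)
      (fun s _ => (hgrd s).continuousAt.continuousWithinAt)
      (fun s _ => (hgrd s).hasDerivWithinAt) continuousOn_const continuousOn_const
      (fun s hs => by
        have hs' : -s ∈ Icc (-T) T := ⟨by linarith [hs.2], by linarith [hs.1]⟩
        have h := (abs_le.1 (hGle (-s) hs')).1
        simp only [hgr_def]
        rw [hgE (-s) hs']; linarith) (t := -t) ⟨by linarith [ht.2], by linarith [ht.1]⟩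
    have hg0 : gr 0 = 0 := by simp [hgr_def, hg_def]
    have hgrt : gr (-t) = E t := by simp only [hgr_def, neg_neg]; exact hgE t ⟨ht.1, by linarith [ht.2]⟩
    rw [hg0, zero_add, hgrt] at key
    have hI : ∫ s in (0 : ℝ)..(-t), A * Real.exp (-∫ u in (0 : ℝ)..s, T⁻¹) ≤ A * T := by
      have ht1 : (0 : ℝ) ≤ -t := by linarith [ht.2]
      have h1 : ∫ s in (0 : ℝ)..(-t), A * Real.exp (-∫ u in (0 : ℝ)..s, T⁻¹)
          ≤ ∫ s in (0 : ℝ)..(-t), A := by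
        refine intervalIntegral.integral_mono_on ht1 ?_ intervalIntegrable_const fun s hs => ?_
        · have hcont : Continuous fun s : ℝ => A * Real.exp (-∫ u in (0 : ℝ)..s, T⁻¹) := by
            simp only [intervalIntegral.integral_const, sub_zero, smul_eq_mul]
            fun_prop
          exact hcont.intervalIntegrable _ _
        · have : Real.exp (-∫ u in (0 : ℝ)..s, T⁻¹) ≤ 1 := by
            rw [intervalIntegral.integral_const, smul_eq_mul, Real.exp_le_one_iff]
            have : 0 ≤ (s - 0) * T⁻¹ := mul_nonneg (by linarith [hs.1]) (inv_pos.2 hT).le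
            linarith
          calc A * Real.exp (-∫ u in (0 : ℝ)..s, T⁻¹) ≤ A * 1 :=
                mul_le_mul_of_nonneg_left this hA0
            _ = A := mul_one A
      have h2 : ∫ s in (0 : ℝ)..(-t), A = A * (-t) := by
        rw [intervalIntegral.integral_const, smul_eq_mul]; ring
      rw [h2] at h1
      exact h1.trans (mul_le_mul_of_nonneg_left (by linarith [ht.1]) hA0)
    have hexp : Real.exp (∫ s in (0 : ℝ)..(-t), T⁻¹) ≤ Real.exp 1 := by
      rw [intervalIntegral.integral_const, smul_eq_mul, Real.exp_le_exp, sub_zero]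
      calc -t * T⁻¹ ≤ T * T⁻¹ := mul_le_mul_of_nonneg_right (by linarith [ht.1]) (inv_pos.2 hT).le
        _ = 1 := mul_inv_cancel₀ hT.ne'
    calc E t ≤ Real.exp (∫ s in (0 : ℝ)..(-t), T⁻¹)
          * ∫ s in (0 : ℝ)..(-t), A * Real.exp (-∫ u in (0 : ℝ)..s, T⁻¹) := key
      _ ≤ Real.exp 1 * (A * T) :=
          mul_le_mul hexp hI (intervalIntegral.integral_nonneg (by linarith [ht.2])
            fun s _ => by positivity) (Real.exp_pos _).le
      _ = Real.exp 1 * A * T := by ring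
  have hEle : ∀ t ∈ Icc (-T) T, E t ≤ Real.exp 1 * (b - a) * K ^ 2 * T ^ 2 := by
    intro t ht
    have h : E t ≤ Real.exp 1 * A * T := by
      rcases le_total 0 t with h0 | h0
      · exact hfwd t ⟨h0, ht.2⟩
      · exact hbwd t ⟨ht.1, h0⟩
    calc E t ≤ Real.exp 1 * A * T := h
      _ = Real.exp 1 * (b - a) * K ^ 2 * T ^ 2 := by simp only [hA_def]; ring
  -- from the interval integral to the total `lintegral`
  intro t ht
  have ht' : t ∈ Ioo (-T - 1) (T + 1) := hTT ht
  have hvan : ∀ x, x ∉ Ioc a b → ENNReal.ofReal (energyDensity V w t x) = 0 := by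
    intro x hx
    rw [hedens]
    have hx' : x < a + 1 ∨ b - 1 < x := by
      by_contra hcon
      push Not at hcon
      exact hx ⟨by linarith [hcon.1], by linarith [hcon.2]⟩
    rw [he0' t ht' x hx', ENNReal.ofReal_zero]
  have hsplit : (∫⁻ x, ENNReal.ofReal (energyDensity V w t x))
      = ∫⁻ x in Ioc a b, ENNReal.ofReal (energyDensity V w t x) := by
    rw [← lintegral_indicator measurableSet_Ioc]
    refine lintegral_congr fun x => ?_
    by_cases hx : x ∈ Ioc a b
    · rw [indicator_of_mem hx]
    · rw [indicator_of_notMem hx, hvan x hx]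
  rw [hsplit]
  have hcont : Continuous fun x => energyDensity V w t x := by
    have : (fun x => energyDensity V w t x) = fun x => e (t, x) := funext (hedens t)
    rw [this]
    exact hec.comp (Continuous.prodMk_right t)
  rw [lintegral_Ioc_eq_ofReal_intervalIntegral hcont (fun x => by rw [hedens]; exact he0 _) hab']
  refine ENNReal.ofReal_le_ofReal ?_
  have : (∫ x in a..b, energyDensity V w t x) = E t := by
    simp only [hE_def]
    exact intervalIntegral.integral_congr fun x _ => hedens t x
  rw [this]
  exact hEle t ht

/-- **Registered sub-goal `stub_restPacket_energyBound`** (item stmt-FinalStateConjecture-10045, prover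
seat 1): `total_energy_le_of_defect` with all binders explicit and fully qualified names. -/
theorem stub_restPacket_energyBound :
    ∀ (w : ℝ → ℝ → ℝ) (V : ℝ → ℝ) (T a b K : ℝ), ContDiff ℝ 2 (Function.uncurry w) →
      ContDiff ℝ 1 V → (∀ x, 0 ≤ V x) → 0 < T → a + 1 < b - 1 →
      (∀ t ∈ Set.Ioo (-T - 1) (T + 1), ∀ x, (x < a + 1 ∨ b - 1 < x) → w t x = 0) →
      (∀ x, w 0 x = 0) → (∀ x, deriv (fun τ => w τ x) 0 = 0) →
      (∀ t ∈ Set.Icc (-T) T, ∀ x,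
        |iteratedDeriv 2 (fun τ => w τ x) t - iteratedDeriv 2 (w t) x + V x * w t x| ≤ K) →
      ∀ t ∈ Set.Icc (-T) T,
        (∫⁻ x, ENNReal.ofReal (Literature.Geometry.Lorentzian.ReggeWheeler.energyDensity V w t x))
          ≤ ENNReal.ofReal (Real.exp 1 * (b - a) * K ^ 2 * T ^ 2) :=
  fun _ _ _ _ _ _ hw hV hV0 hT hab hsupp h0 h1 hdef =>
    total_energy_le_of_defect hw hV hV0 hT hab hsupp h0 h1 hdef

end Summit.FinalStateConjecture.FinalStateConjecture.Theorems.RestPacket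

end
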